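import Mathlib
import HarnessLib

/-!
# Route `KLProgramme` — crux C4a, S3 brick (B4, DIRECT SHEET): TRANSVERSAL TWO-ZERO CONTROL — a profile vanishing at the simple zeros of another is
# controlled by it (the generic / near-Cooper half of the band-distance control of the anisotropy defect)

Cell `gate-hubbard-kl`, seat hubbard-kl-k3c3-p3 (g25; row «implicit-function / monotonicity route for μ(n)»).  Located brick «(B4)-DIRECT-COUNT», companion of
`…C4aTwoNodeControl` (the near-TANGENCY half, where the two direct crossings `φ = 0, ϑ` merge and convexity is the mechanism) and `…C4aEnvelopePreservation`
(the power-counting consequence); for the (C)-closer lane hubbard-kl-c4a-1 (stub (C) `stub_twoLeg_curvature` of `KLRegimeEngineV17F2`,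
stmt-HubbardSuperconductivity-20437; memo HOME/hubbard-kl-k3c3-p3/B4-DIRECT-COUNT.md §1).

THE MECHANISM (generic direct configurations and near Cooper).  On the direct sheet the level-`0` partner band `f = ē(0,·)` has exactly two zeros on
the loop circle, the θ-FIXED crossings `φ = 0` (loop at `k`) and `φ = ϑ` (loop at `q′`), both transversal with slope `≍ T(ϑ,θ)` (`…C4aPartnerBandCrossings`,
`…C4aLoopNondegeneracy`: `|ē| + |∂_φ ē| ≥ c` on the direct sheet); every base-angle jet `h = ∂ᵐ_θ ē(0,·)` vanishes at the same two points
(`…C4aTwoNodeControl.iteratedDeriv_partnerBand_pp_base_at_k/_at_q`).  Then `|h| ≤ Q·|f|` on the whole circle with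
`Q = max(H₁/σ, H₀/κ)` from: a linear lower bound `σ·dist ≤ |f|` on `δ`-neighbourhoods of the zeros, a floor `κ ≤ |f|` off them, a Lipschitz bound `|h| ≤ H₁·dist`
near the zeros and a ceiling `|h| ≤ H₀`.  Near the Cooper configuration `ϑ = π + η` all four constants scale with `|η|` (exact nesting at `η = 0`:
`ē ≡ e`), so `Q` is `η`-free — the statement is written in the ratio form precisely so that this uniformity is automatic.

* `abs_sub_ge_of_deriv_ge` — MVT: `σ ≤ f′` on `[z−δ, z+δ]`, `f z = 0` ⇒ `σ·|t − z| ≤ |f t|` there (and the mirror `f′ ≤ −σ`);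
* `abs_le_mul_dist_of_deriv_le` — `|h′| ≤ H₁` near `z`, `h z = 0` ⇒ `|h t| ≤ H₁·|t − z|`;
* **`abs_le_mul_abs_of_transversal_zeros`** — the control `|h t| ≤ max(H₁/σ, H₀/κ)·|f t|` on a set `S` covered by the two `δ`-neighbourhoods and the floor region;
* transport along a displacement (`|H − h| ≤ ℓ₁`, `|F − f| ≤ ℓ₀`): reuse `…C4aTwoNodeControl.abs_le_mul_abs_add_of_displacement`.

Pure calculus (carrier-free); nothing about the Hubbard model's sizes; nothing asserts (C), K3 or superconductivity.  References: FST II = Feldman–Salmhofer–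
Trubowitz CPAM 51 (1998) §3; BGM 2006 §2.4 [cite: BenfattoGiulianiMastropietro2006].
-/

noncomputable section

namespace Summit.HubbardSuperconductivity.HubbardSuperconductivity.Theorems.C4a

set_option linter.dupNamespace false -- summit = problem name (single-conjunct summit), D-0017

open Real Set

/-! ## §1 Linear bounds near a simple zero (mean value theorem) -/

/-- **Lower linear bound at a transversal zero**: `f` differentiable with `σ ≤ f′` on `[z−δ, z+δ]` and `f z = 0` ⇒ `σ·|t−z| ≤ |f t|` for `|t − z| ≤ δ`. -/
theorem abs_sub_ge_of_deriv_ge {f f' : ℝ → ℝ} {z δ σ : ℝ} (hf : ∀ x ∈ Icc (z - δ) (z + δ), HasDerivAt f (f' x) x)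
    (hσ : ∀ x ∈ Icc (z - δ) (z + δ), σ ≤ f' x) (hz : f z = 0) {t : ℝ} (ht : |t - z| ≤ δ) : σ * |t - z| ≤ |f t| := by
  have htI : t ∈ Icc (z - δ) (z + δ) := by constructor <;> linarith [abs_le.1 ht]
  have hzI : z ∈ Icc (z - δ) (z + δ) := by constructor <;> linarith [(abs_nonneg (t - z)).trans ht]
  rcases lt_trichotomy t z with hlt | rfl | hgt
  · -- t < z: f z - f t ≥ σ (z - t)
    have hsub : Icc t z ⊆ Icc (z - δ) (z + δ) := Icc_subset_Icc htI.1 hzI.2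
    have hmvt := exists_hasDerivAt_eq_slope f f' hlt
      (fun x hx => (hf x (hsub hx)).continuousAt.continuousWithinAt) (fun x hx => hf x (hsub (Ioo_subset_Icc_self hx)))
    obtain ⟨ξ, hξ, hξ'⟩ := hmvt
    have hξσ : σ ≤ f' ξ := hσ ξ (hsub (Ioo_subset_Icc_self hξ))
    have hslope : σ ≤ (f z - f t) / (z - t) := hξ' ▸ hξσ
    have hpos : 0 < z - t := by linarith
    have h1 : σ * (z - t) ≤ f z - f t := (le_div_iff₀ hpos).1 hslope
    rw [hz, zero_sub] at h1
    rw [abs_of_neg (by linarith : t - z < 0)]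
    calc σ * -(t - z) = σ * (z - t) := by ring
      _ ≤ -f t := h1
      _ ≤ |f t| := neg_le_abs _
  · simp [hz]
  · have hsub : Icc z t ⊆ Icc (z - δ) (z + δ) := Icc_subset_Icc hzI.1 htI.2
    have hmvt := exists_hasDerivAt_eq_slope f f' hgt
      (fun x hx => (hf x (hsub hx)).continuousAt.continuousWithinAt) (fun x hx => hf x (hsub (Ioo_subset_Icc_self hx)))
    obtain ⟨ξ, hξ, hξ'⟩ := hmvt
    have hξσ : σ ≤ f' ξ := hσ ξ (hsub (Ioo_subset_Icc_self hξ))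
    have hslope : σ ≤ (f t - f z) / (t - z) := hξ' ▸ hξσ
    have hpos : 0 < t - z := by linarith
    have h1 : σ * (t - z) ≤ f t - f z := (le_div_iff₀ hpos).1 hslope
    rw [hz, sub_zero] at h1
    rw [abs_of_pos hpos]
    exact h1.trans (le_abs_self _)

/-- Mirror form: `f′ ≤ −σ` near the zero ⇒ `σ·|t−z| ≤ |f t|`. -/
theorem abs_sub_ge_of_deriv_le_neg {f f' : ℝ → ℝ} {z δ σ : ℝ} (hf : ∀ x ∈ Icc (z - δ) (z + δ), HasDerivAt f (f' x) x)
    (hσ : ∀ x ∈ Icc (z - δ) (z + δ), f' x ≤ -σ) (hz : f z = 0) {t : ℝ} (ht : |t - z| ≤ δ) : σ * |t - z| ≤ |f t| := by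
  have h := abs_sub_ge_of_deriv_ge (f := fun x => -f x) (f' := fun x => -f' x) (fun x hx => (hf x hx).neg)
    (fun x hx => by have := hσ x hx; linarith) (by simp [hz]) ht
  simpa [abs_neg] using h

/-- **Upper linear bound at a zero**: `|h′| ≤ H₁` on `[z−δ, z+δ]`, `h z = 0` ⇒ `|h t| ≤ H₁·|t−z|` for `|t − z| ≤ δ`. -/
theorem abs_le_mul_dist_of_deriv_le {h h' : ℝ → ℝ} {z δ H₁ : ℝ} (hh : ∀ x ∈ Icc (z - δ) (z + δ), HasDerivAt h (h' x) x)
    (hH : ∀ x ∈ Icc (z - δ) (z + δ), |h' x| ≤ H₁) (hz : h z = 0) {t : ℝ} (ht : |t - z| ≤ δ) : |h t| ≤ H₁ * |t - z| := by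
  have htI : t ∈ Icc (z - δ) (z + δ) := by constructor <;> linarith [abs_le.1 ht]
  have hzI : z ∈ Icc (z - δ) (z + δ) := by constructor <;> linarith [(abs_nonneg (t - z)).trans ht]
  have hconv : Convex ℝ (Icc (z - δ) (z + δ)) := convex_Icc _ _
  have hdiff : ∀ x ∈ Icc (z - δ) (z + δ), HasDerivWithinAt h (h' x) (Icc (z - δ) (z + δ)) x :=
    fun x hx => (hh x hx).hasDerivWithinAt
  have hbound : ∀ x ∈ Icc (z - δ) (z + δ), ‖h' x‖ ≤ H₁ := fun x hx => by rw [Real.norm_eq_abs]; exact hH x hx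
  have key := hconv.norm_image_sub_le_of_norm_hasDerivWithin_le hdiff hbound hzI htI
  rw [hz, sub_zero, Real.norm_eq_abs, Real.norm_eq_abs] at key
  exact key

/-! ## §2 Transversal two-zero control -/

/-- **TRANSVERSAL TWO-ZERO CONTROL.**  On a set `S` covered by the `δ`-neighbourhoods of two points `z₁, z₂` and a floor region: if
`σ·|t − zᵢ| ≤ |f t|` and `|h t| ≤ H₁·|t − zᵢ|` for `|t − zᵢ| ≤ δ`, and `κ ≤ |f t|`, `|h t| ≤ H₀` at the points of `S` outside both neighbourhoods
(`σ, κ > 0`, `H₀, H₁ ≥ 0`), then `|h t| ≤ max(H₁/σ, H₀/κ)·|f t|` for every `t ∈ S`. -/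
theorem abs_le_mul_abs_of_transversal_zeros {f h : ℝ → ℝ} {S : Set ℝ} {z₁ z₂ δ σ κ H₀ H₁ : ℝ} (hσ : 0 < σ) (hκ : 0 < κ)
    (hH₀ : 0 ≤ H₀) (hH₁ : 0 ≤ H₁)
    (hf₁ : ∀ t, |t - z₁| ≤ δ → σ * |t - z₁| ≤ |f t|) (hh₁ : ∀ t, |t - z₁| ≤ δ → |h t| ≤ H₁ * |t - z₁|)
    (hf₂ : ∀ t, |t - z₂| ≤ δ → σ * |t - z₂| ≤ |f t|) (hh₂ : ∀ t, |t - z₂| ≤ δ → |h t| ≤ H₁ * |t - z₂|)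
    (hfloor : ∀ t ∈ S, δ < |t - z₁| → δ < |t - z₂| → κ ≤ |f t|) (hceil : ∀ t ∈ S, δ < |t - z₁| → δ < |t - z₂| → |h t| ≤ H₀)
    {t : ℝ} (ht : t ∈ S) : |h t| ≤ max (H₁ / σ) (H₀ / κ) * |f t| := by
  have hQ : 0 ≤ max (H₁ / σ) (H₀ / κ) := le_max_of_le_left (div_nonneg hH₁ hσ.le)
  by_cases h1 : |t - z₁| ≤ δ
  · calc |h t| ≤ H₁ * |t - z₁| := hh₁ t h1
      _ = H₁ / σ * (σ * |t - z₁|) := by field_simp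
      _ ≤ H₁ / σ * |f t| := mul_le_mul_of_nonneg_left (hf₁ t h1) (div_nonneg hH₁ hσ.le)
      _ ≤ max (H₁ / σ) (H₀ / κ) * |f t| := mul_le_mul_of_nonneg_right (le_max_left _ _) (abs_nonneg _)
  by_cases h2 : |t - z₂| ≤ δ
  · calc |h t| ≤ H₁ * |t - z₂| := hh₂ t h2
      _ = H₁ / σ * (σ * |t - z₂|) := by field_simp
      _ ≤ H₁ / σ * |f t| := mul_le_mul_of_nonneg_left (hf₂ t h2) (div_nonneg hH₁ hσ.le)
      _ ≤ max (H₁ / σ) (H₀ / κ) * |f t| := mul_le_mul_of_nonneg_right (le_max_left _ _) (abs_nonneg _)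
  push Not at h1 h2
  calc |h t| ≤ H₀ := hceil t ht h1 h2
    _ = H₀ / κ * κ := by field_simp
    _ ≤ H₀ / κ * |f t| := mul_le_mul_of_nonneg_left (hfloor t ht h1 h2) (div_nonneg hH₀ hκ.le)
    _ ≤ max (H₁ / σ) (H₀ / κ) * |f t| := mul_le_mul_of_nonneg_right (le_max_right _ _) (abs_nonneg _)

/-- **… from derivative data** (the form the suppliers give): `f, h` differentiable near the zeros with `σ ≤ εᵢ·f′` (`εᵢ = ±1`, the crossing
orientation) and `|h′| ≤ H₁` on `[zᵢ − δ, zᵢ + δ]` (`δ ≥ 0`), `f zᵢ = h zᵢ = 0`; floor / ceiling off the neighbourhoods. -/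
theorem abs_le_mul_abs_of_transversal_zeros_deriv {f f' h h' : ℝ → ℝ} {S : Set ℝ} {z₁ z₂ δ σ κ H₀ H₁ : ℝ} (hσ : 0 < σ) (hκ : 0 < κ)
    (hH₀ : 0 ≤ H₀) (hδ : 0 ≤ δ) {ε₁ ε₂ : ℝ} (hε₁ : ε₁ = 1 ∨ ε₁ = -1) (hε₂ : ε₂ = 1 ∨ ε₂ = -1)
    (hf : ∀ i ∈ ({z₁, z₂} : Set ℝ), ∀ x ∈ Icc (i - δ) (i + δ), HasDerivAt f (f' x) x)
    (hh : ∀ i ∈ ({z₁, z₂} : Set ℝ), ∀ x ∈ Icc (i - δ) (i + δ), HasDerivAt h (h' x) x)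
    (hσ₁ : ∀ x ∈ Icc (z₁ - δ) (z₁ + δ), σ ≤ ε₁ * f' x) (hσ₂ : ∀ x ∈ Icc (z₂ - δ) (z₂ + δ), σ ≤ ε₂ * f' x)
    (hH : ∀ i ∈ ({z₁, z₂} : Set ℝ), ∀ x ∈ Icc (i - δ) (i + δ), |h' x| ≤ H₁)
    (hfz₁ : f z₁ = 0) (hfz₂ : f z₂ = 0) (hhz₁ : h z₁ = 0) (hhz₂ : h z₂ = 0)
    (hfloor : ∀ t ∈ S, δ < |t - z₁| → δ < |t - z₂| → κ ≤ |f t|) (hceil : ∀ t ∈ S, δ < |t - z₁| → δ < |t - z₂| → |h t| ≤ H₀)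
    {t : ℝ} (ht : t ∈ S) : |h t| ≤ max (H₁ / σ) (H₀ / κ) * |f t| := by
  have hz₁ : z₁ ∈ ({z₁, z₂} : Set ℝ) := Set.mem_insert _ _
  have hz₂ : z₂ ∈ ({z₁, z₂} : Set ℝ) := Set.mem_insert_of_mem _ rfl
  have hH₁ : 0 ≤ H₁ := (abs_nonneg _).trans (hH z₁ hz₁ z₁ ⟨by linarith, by linarith⟩)
  -- lower / upper linear bounds at each zero
  have lower : ∀ {z ε}, (ε = 1 ∨ ε = -1) → z ∈ ({z₁, z₂} : Set ℝ) → (∀ x ∈ Icc (z - δ) (z + δ), σ ≤ ε * f' x) → f z = 0 →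
      ∀ t, |t - z| ≤ δ → σ * |t - z| ≤ |f t| := by
    intro z ε hε hz hσz hfz t ht
    rcases hε with rfl | rfl
    · exact abs_sub_ge_of_deriv_ge (hf z hz) (fun x hx => by simpa using hσz x hx) hfz ht
    · exact abs_sub_ge_of_deriv_le_neg (hf z hz) (fun x hx => by have := hσz x hx; linarith) hfz ht
  exact abs_le_mul_abs_of_transversal_zeros hσ hκ hH₀ hH₁ (lower hε₁ hz₁ hσ₁ hfz₁)
    (fun t ht' => abs_le_mul_dist_of_deriv_le (hh z₁ hz₁) (hH z₁ hz₁) hhz₁ ht') (lower hε₂ hz₂ hσ₂ hfz₂)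
    (fun t ht' => abs_le_mul_dist_of_deriv_le (hh z₂ hz₂) (hH z₂ hz₂) hhz₂ ht') hfloor hceil ht

end Summit.HubbardSuperconductivity.HubbardSuperconductivity.Theorems.C4a

end
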